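import Summits.HubbardSuperconductivity.HubbardLadder.NeelOrderParamCeiling
import Literature.MathematicalPhysics.QuantumLattice.HeisenbergMarshallCorrelationSign
import Literature.MathematicalPhysics.QuantumLattice.HeisenbergSquareDimerBound
import HarnessLib

/-!
# R2 rows: the Marshall-sign energy floor `m_s²(L) ≥ 4|E₀(L)|/L⁴` for the spin-½ Heisenberg model on the even torus — energy-assisted rows at `L = 4, …, 12`, the energy-free floor `m_s²(L) ≥ 3/(2L²)`, and two-sided brackets

HONEST FRAMING: ladder R1–R4 with certified numbers; no claim on H/H₀. Cell pub-hubbard, seat r2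
(gen 6). Each theorem is a statement about ONE finite matrix; none bears on H₀ (no limit `L → ∞` is
taken: the floors below decay like `1/L²` and say nothing about long-range order).

The LOWER endpoint of the R2 observable
`m_s²(L) = neelOrderParamSq L J = L⁻⁴ Σ_{x,y} ε_xε_y ⟨𝐒_x·𝐒_y⟩₀` (tracial ground state of
`heisenbergTorus 2 L 1 J`, `J > 0`, `L` even) by a SECOND, solver-free device, complementary to the
Kennedy–Lieb–Shastry two-sum rule of `NeelTwoSumRuleRows{,Eight,Ten}`: the tree's
Marshall–Lieb–Mattis kernel `neelSum_groundStateSpinCorrTorus_ge`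
(`Literature/…/HeisenbergMarshallCorrelationSign.lean`: opposite-parity correlations are `≤ 0` by
Marshall's sign rule, `Σ_{x,y} ⟨𝐒_x·𝐒_y⟩₀ = 0` since the ground state is a singlet, and the nearest-
neighbour correlations sum to `2E₀` by the energy sum rule) gives

  **`m_s²(L) ≥ -4 E₀(L) / L⁴`**  (`neelOrderParamSq_ge_of_groundEnergy`, even `L ≥ 4`, `J > 0`,
  `E₀(L) = groundEnergy (heisenbergTorus 2 L 1 1) < 0`).

Rows (R2-TABLE §A8, new column "Marshall floor"); energy inputs are the SAME pub-mbboot certified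
upper bounds [H_L] already used as hypotheses by the KLS rows (inherited certificates, cited not
recomputed), so the rows compose with the landed ones:

* `neelOrderParamSq_four_ge_marshall_of_groundEnergy_le` :
  `E₀(4×4) ≤ -11.2284831934 → 0.1754 ≤ m_s²(4)` (weaker than the KLS row `0.1938`; listed for the
  crossover);
* `…_six_…`   : `E₀(6×6) ≤ -24.0846218 → 0.0743 ≤ m_s²(6)` (KLS row: `0.0892`);
* `…_eight_…` : `E₀(8×8) ≤ -39.9615808 → 0.0390 ≤ m_s²(8)` (**improves** the KLS row `0.0355`);
* `…_ten_…`   : `E₀(10×10) ≤ -58.40533 → 0.0233 ≤ m_s²(10)` (**improves** KLS `0.0043` fivefold);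
* `…_twelve_…`: `E₀(12×12) ≤ -90.9388 → 0.0175 ≤ m_s²(12)` (KLS: NO positive bound at `L = 12` —
  its method ceiling; hypothesis = pub-mbboot [H_12] `E₀/144 ≤ -0.6315201`, i.e. `E₀ ≤ -90.93889`).

ENERGY-FREE floor: with the tree's columnar-dimer bound `E₀(L) ≤ -(3/8)L²`
(`heisenbergSquareTorus_groundEnergy_le_dimer`, no numerical input) the kernel alone proves
**`m_s²(L) ≥ 3/(2L²)` for every even `L ≥ 4` and `J > 0`**
(`neelOrderParamSq_ge_three_div_two_sq`; rows `0.015 ≤ m_s²(10)` — improving the energy-free KLS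
row `0.0041` —, `0.0104 ≤ m_s²(12)`, `0.0058 ≤ m_s²(16)`), and with the operator ceiling
`m_s²(L) ≤ ¼ + 1/L²` (`neelOrderParamSq_le`, `NeelOrderParamCeiling`) the two-sided kernel brackets
`neelOrderParamSq_ten_mem_Icc_marshall : 0 < J → m_s²(10) ∈ [0.015, 0.26]`,
`neelOrderParamSq_twelve_mem_Icc : m_s²(12) ∈ [0.0104, 0.257]`,
`neelOrderParamSq_sixteen_mem_Icc : m_s²(16) ∈ [0.0058, 0.254]` and the energy-assisted
`…_eight/ten/twelve_mem_Icc_marshall_of_groundEnergy_le`. QMC comparators (never inputs):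
`m_s²(8) = 0.1778419(2)`, `m_s²(10) = 0.1593710(2)`, `m_s²(12) ≈ 0.146`, `m_s²(16) ≈ 0.13`
(Sandvik).

References: W. Marshall, Proc. Roy. Soc. A 232 (1955) 48; E. Lieb, D. Mattis, J. Math. Phys. 3
(1962) 749, Thm 2; T. Kennedy, E. H. Lieb, B. S. Shastry, J. Stat. Phys. 53 (1988) 1019, eq. (3);
A. W. Sandvik, Phys. Rev. B 56 (1997) 11678 (comparators).
-/

noncomputable section

open Matrix Complex Finset Literature.MathematicalPhysics.QuantumLattice
  Literature.Probability.LatticeModels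
open scoped ComplexOrder

namespace Summit.HubbardSuperconductivity.HubbardLadder

/-! ### The Marshall floor `m_s²(L) ≥ -4E₀(L)/L⁴` and its energy-free form `≥ 3/(2L²)` -/

/-- **R2 Marshall floor: `m_s²(L) ≥ -4 E₀(L)/L⁴`** for even `L ≥ 4` (`3 ≤ L` suffices) and `J > 0`,
`E₀(L)` the ground-state energy of `heisenbergTorus 2 L 1 1` (a bound on ONE finite matrix's
ground-state functional; no bearing on H₀). Marshall sign rule + singlet + energy sum rule
(`neelSum_groundStateSpinCorrTorus_ge`) with the canonical-representative sign `stagSign = ±1` on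
the parity sublattices (`evenRepSites_eq_evenSublattice`). [cite: LiebMattis1962, Theorem 2]
[cite: KLS1988JSP, eq. (3)] -/
theorem neelOrderParamSq_ge_of_groundEnergy (L : ℕ) [NeZero L] (hL2 : 2 ∣ L) (hL3 : 3 ≤ L)
    {J : ℝ} (hJ : 0 < J) :
    -4 * (heisenbergTorus 2 L 1 1).groundEnergy / (L : ℝ) ^ 4 ≤ neelOrderParamSq L J := by
  obtain ⟨k, rfl⟩ : ∃ k, L = k + 1 := ⟨L - 1, by have := NeZero.ne L; omega⟩
  rw [neelOrderParamSq_succ]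
  refine div_le_div_of_nonneg_right ?_ (by positivity)
  have h := neelSum_groundStateSpinCorrTorus_ge (d := 2) (k + 1) hL2 hL3 0 1 hJ stagSign
    (fun x hx => stagSign_of_mem (by rw [evenRepSites_eq_evenSublattice hL2]; exact hx))
    (fun x hx => stagSign_of_not_mem (by rw [evenRepSites_eq_evenSublattice hL2]; exact hx))
  simpa only [stagSign] using h

/-- **R2 energy-free Marshall floor: `m_s²(L) ≥ 3/(2L²)`** for every even `L ≥ 4` and `J > 0` — the
Marshall floor composed with the tree's columnar-dimer variational bound `E₀(L) ≤ -(3/8)L²`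
(`heisenbergSquareTorus_groundEnergy_le_dimer`); NO numerical input. (Decays like `1/L²`: a
statement about each finite torus, not about long-range order.) [cite: LiebMattis1962, Theorem 2]
[cite: KLS1988JSP, eq. (3)] -/
theorem neelOrderParamSq_ge_three_div_two_sq (L : ℕ) [NeZero L] (hL2 : 2 ∣ L) (hL4 : 4 ≤ L)
    {J : ℝ} (hJ : 0 < J) :
    3 / (2 * (L : ℝ) ^ 2) ≤ neelOrderParamSq L J := by
  have h := neelOrderParamSq_ge_of_groundEnergy L hL2 (by omega) hJ
  have hE : (heisenbergTorus 2 L 1 1).groundEnergy ≤ -(3 * 1 / 8) * (L : ℝ) ^ 2 :=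
    heisenbergSquareTorus_groundEnergy_le_dimer zero_le_one L hL2 hL4
  have hL : (0 : ℝ) < (L : ℝ) := by
    have : 0 < L := by omega
    exact_mod_cast this
  have hL4' : (0 : ℝ) < (L : ℝ) ^ 4 := by positivity
  calc 3 / (2 * (L : ℝ) ^ 2)
      = -4 * (-(3 * 1 / 8) * (L : ℝ) ^ 2) / (L : ℝ) ^ 4 := by
        field_simp
        ring
    _ ≤ -4 * (heisenbergTorus 2 L 1 1).groundEnergy / (L : ℝ) ^ 4 :=
        div_le_div_of_nonneg_right (by linarith) hL4'.le
    _ ≤ neelOrderParamSq L J := h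

/-! ### Energy-assisted rows (R2-TABLE §A8, column "Marshall floor"; hypotheses = [H_L]) -/

/-- From the floor: `c · L⁴ ≤ -4·Eup` and `E₀ ≤ Eup` give `c ≤ m_s²(L)`. [folklore] -/
private theorem row_of_floor {L : ℕ} [NeZero L] (hL2 : 2 ∣ L) (hL3 : 3 ≤ L) {J : ℝ} (hJ : 0 < J)
    {Eup c : ℝ} (hE : (heisenbergTorus 2 L 1 1).groundEnergy ≤ Eup)
    (hc : c * (L : ℝ) ^ 4 ≤ -4 * Eup) : c ≤ neelOrderParamSq L J := by
  have h := neelOrderParamSq_ge_of_groundEnergy L hL2 hL3 hJ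
  have hL : (0 : ℝ) < (L : ℝ) := by
    have : 0 < L := by omega
    exact_mod_cast this
  have hL4 : (0 : ℝ) < (L : ℝ) ^ 4 := by positivity
  have h1 : c ≤ -4 * (heisenbergTorus 2 L 1 1).groundEnergy / (L : ℝ) ^ 4 := by
    rw [le_div_iff₀ hL4]
    linarith
  exact h1.trans h

/-- Row A8.4 (Marshall column): `E₀(4×4) ≤ -11.2284831934 → 0.1754 ≤ m_s²(4)` (hypothesis =
pub-mbboot's certified [H_4] upper, the one of `neelOrderParamSq_four_ge_of_groundEnergy_le`;
weaker than that KLS row `0.1938`; comparator ED `0.2765271`). [cite: LiebMattis1962, Theorem 2]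
[cite: KLS1988JSP, eq. (3)] -/
theorem neelOrderParamSq_four_ge_marshall_of_groundEnergy_le (J : ℝ) (hJ : 0 < J)
    (hE : (heisenbergTorus 2 4 1 1).groundEnergy ≤ -11.2284831934) :
    (0.1754 : ℝ) ≤ neelOrderParamSq 4 J :=
  row_of_floor (by norm_num) (by norm_num) hJ hE (by norm_num)

/-- Row A8.6 (Marshall column): `E₀(6×6) ≤ -24.0846218 → 0.0743 ≤ m_s²(6)` (hypothesis = pub-mbboot
[H_6] integer-MPS upper; weaker than the KLS row `0.0892`; comparator QMC `0.2098368(2)`).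
[cite: LiebMattis1962, Theorem 2] [cite: KLS1988JSP, eq. (3)] -/
theorem neelOrderParamSq_six_ge_marshall_of_groundEnergy_le (J : ℝ) (hJ : 0 < J)
    (hE : (heisenbergTorus 2 6 1 1).groundEnergy ≤ -24.0846218) :
    (0.0743 : ℝ) ≤ neelOrderParamSq 6 J :=
  row_of_floor (by norm_num) (by norm_num) hJ hE (by norm_num)

/-- Row A8.8 (Marshall column): `E₀(8×8) ≤ -39.9615808 → 0.0390 ≤ m_s²(8)` (hypothesis = pub-mbboot
[H_8] cluster-mean-field upper `E₀/64 ≤ -0.6243997`; IMPROVES the KLS row `0.0355`; comparator QMC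
`0.1778419(2)`, Sandvik). [cite: LiebMattis1962, Theorem 2] [cite: KLS1988JSP, eq. (3)] -/
theorem neelOrderParamSq_eight_ge_marshall_of_groundEnergy_le (J : ℝ) (hJ : 0 < J)
    (hE : (heisenbergTorus 2 8 1 1).groundEnergy ≤ -39.9615808) :
    (0.0390 : ℝ) ≤ neelOrderParamSq 8 J :=
  row_of_floor (by norm_num) (by norm_num) hJ hE (by norm_num)

/-- Row A8.10 (Marshall column): `E₀(10×10) ≤ -58.40533 → 0.0233 ≤ m_s²(10)` (hypothesis =
pub-mbboot [H_10] upper `E₀/100 ≤ -0.5840533`; IMPROVES the KLS row `0.0043` fivefold; comparator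
QMC `0.1593710(2)`). [cite: LiebMattis1962, Theorem 2] [cite: KLS1988JSP, eq. (3)] -/
theorem neelOrderParamSq_ten_ge_marshall_of_groundEnergy_le (J : ℝ) (hJ : 0 < J)
    (hE : (heisenbergTorus 2 10 1 1).groundEnergy ≤ -58.40533) :
    (0.0233 : ℝ) ≤ neelOrderParamSq 10 J :=
  row_of_floor (by norm_num) (by norm_num) hJ hE (by norm_num)

/-- Row A8.12 (Marshall column): `E₀(12×12) ≤ -90.9388 → 0.0175 ≤ m_s²(12)` (hypothesis implied by
pub-mbboot [H_12] upper `E₀/144 ≤ -0.6315201`, i.e. `E₀ ≤ -90.93889`; the KLS two-sum rule gives NO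
positive bound at `L = 12`; comparator QMC `≈ 0.146`). [cite: LiebMattis1962, Theorem 2]
[cite: KLS1988JSP, eq. (3)] -/
theorem neelOrderParamSq_twelve_ge_marshall_of_groundEnergy_le (J : ℝ) (hJ : 0 < J)
    (hE : (heisenbergTorus 2 12 1 1).groundEnergy ≤ -90.9388) :
    (0.0175 : ℝ) ≤ neelOrderParamSq 12 J :=
  row_of_floor (by norm_num) (by norm_num) hJ hE (by norm_num)

/-! ### Energy-free rows and two-sided kernel brackets (no numerical input at all) -/

/-- Row A8.10 (energy-free Marshall column): `0 < J → 0.015 ≤ m_s²(10)` (`= 3/200`; improves the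
energy-free KLS row `0.0041`). [cite: LiebMattis1962, Theorem 2] [cite: KLS1988JSP, eq. (3)] -/
theorem neelOrderParamSq_ten_ge_marshall (J : ℝ) (hJ : 0 < J) :
    (0.015 : ℝ) ≤ neelOrderParamSq 10 J := by
  have h := neelOrderParamSq_ge_three_div_two_sq 10 (by norm_num) (by norm_num) hJ
  norm_num at h ⊢
  exact h

/-- Row A8.12 (energy-free Marshall column): `0 < J → 0.0104 ≤ m_s²(12)` (`3/288 = 0.01041…`).
[cite: LiebMattis1962, Theorem 2] [cite: KLS1988JSP, eq. (3)] -/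
theorem neelOrderParamSq_twelve_ge_marshall (J : ℝ) (hJ : 0 < J) :
    (0.0104 : ℝ) ≤ neelOrderParamSq 12 J := by
  have h := neelOrderParamSq_ge_three_div_two_sq 12 (by norm_num) (by norm_num) hJ
  norm_num at h ⊢
  linarith

/-- Row A8.16 (energy-free Marshall column): `0 < J → 0.0058 ≤ m_s²(16)` (`3/512 = 0.00585…`).
[cite: LiebMattis1962, Theorem 2] [cite: KLS1988JSP, eq. (3)] -/
theorem neelOrderParamSq_sixteen_ge_marshall (J : ℝ) (hJ : 0 < J) :
    (0.0058 : ℝ) ≤ neelOrderParamSq 16 J := by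
  have h := neelOrderParamSq_ge_three_div_two_sq 16 (by norm_num) (by norm_num) hJ
  norm_num at h ⊢
  linarith

/-- Row A8.12 upper: `m_s²(12) ≤ 0.257` (`¼ + 1/144 = 0.25694…`; operator ceiling
`neelOrderParamSq_le`). [cite: Tasaki2020, §2.2, App. A.3] -/
theorem neelOrderParamSq_twelve_le (J : ℝ) : neelOrderParamSq 12 J ≤ 0.257 := by
  have h := neelOrderParamSq_le 11 (by norm_num) J
  norm_num at h ⊢
  linarith

/-- Row A8.16 upper: `m_s²(16) ≤ 0.254` (`¼ + 1/256 = 0.25390625`).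
[cite: Tasaki2020, §2.2, App. A.3] -/
theorem neelOrderParamSq_sixteen_le (J : ℝ) : neelOrderParamSq 16 J ≤ 0.254 := by
  have h := neelOrderParamSq_le 15 (by norm_num) J
  norm_num at h ⊢
  linarith

/-- **Two-sided kernel bracket, `10×10`, energy-free**: `0 < J → m_s²(10) ∈ [0.015, 0.26]`
(lower: Marshall floor ∘ dimer bound; upper: operator ceiling `neelOrderParamSq_ten_le`). No
numerical input. [cite: LiebMattis1962, Theorem 2] [cite: Tasaki2020, App. A.3] -/
theorem neelOrderParamSq_ten_mem_Icc_marshall (J : ℝ) (hJ : 0 < J) :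
    neelOrderParamSq 10 J ∈ Set.Icc (0.015 : ℝ) 0.26 :=
  ⟨neelOrderParamSq_ten_ge_marshall J hJ, neelOrderParamSq_ten_le J⟩

/-- **Two-sided kernel bracket, `12×12`, energy-free**: `0 < J → m_s²(12) ∈ [0.0104, 0.257]`. No
numerical input. [cite: LiebMattis1962, Theorem 2] [cite: Tasaki2020, App. A.3] -/
theorem neelOrderParamSq_twelve_mem_Icc (J : ℝ) (hJ : 0 < J) :
    neelOrderParamSq 12 J ∈ Set.Icc (0.0104 : ℝ) 0.257 :=
  ⟨neelOrderParamSq_twelve_ge_marshall J hJ, neelOrderParamSq_twelve_le J⟩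

/-- **Two-sided kernel bracket, `16×16`, energy-free**: `0 < J → m_s²(16) ∈ [0.0058, 0.254]`. No
numerical input. [cite: LiebMattis1962, Theorem 2] [cite: Tasaki2020, App. A.3] -/
theorem neelOrderParamSq_sixteen_mem_Icc (J : ℝ) (hJ : 0 < J) :
    neelOrderParamSq 16 J ∈ Set.Icc (0.0058 : ℝ) 0.254 :=
  ⟨neelOrderParamSq_sixteen_ge_marshall J hJ, neelOrderParamSq_sixteen_le J⟩

/-- **Two-sided bracket, `8×8`, energy-assisted**:
`E₀(8×8) ≤ -39.9615808 → m_s²(8) ∈ [0.0390, 0.265625]` (sharpens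
`neelOrderParamSq_eight_mem_Icc_of_groundEnergy_le`'s `0.0355`). [cite: LiebMattis1962, Theorem 2]
[cite: Tasaki2020, App. A.3] -/
theorem neelOrderParamSq_eight_mem_Icc_marshall_of_groundEnergy_le (J : ℝ) (hJ : 0 < J)
    (hE : (heisenbergTorus 2 8 1 1).groundEnergy ≤ -39.9615808) :
    neelOrderParamSq 8 J ∈ Set.Icc (0.0390 : ℝ) 0.265625 :=
  ⟨neelOrderParamSq_eight_ge_marshall_of_groundEnergy_le J hJ hE, neelOrderParamSq_eight_le J⟩

/-- **Two-sided bracket, `10×10`, energy-assisted**: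
`E₀(10×10) ≤ -58.40533 → m_s²(10) ∈ [0.0233, 0.26]` (sharpens
`neelOrderParamSq_ten_mem_Icc_of_groundEnergy_le`'s `0.0043`). [cite: LiebMattis1962, Theorem 2]
[cite: Tasaki2020, App. A.3] -/
theorem neelOrderParamSq_ten_mem_Icc_marshall_of_groundEnergy_le (J : ℝ) (hJ : 0 < J)
    (hE : (heisenbergTorus 2 10 1 1).groundEnergy ≤ -58.40533) :
    neelOrderParamSq 10 J ∈ Set.Icc (0.0233 : ℝ) 0.26 :=
  ⟨neelOrderParamSq_ten_ge_marshall_of_groundEnergy_le J hJ hE, neelOrderParamSq_ten_le J⟩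

/-- **Two-sided bracket, `12×12`, energy-assisted**:
`E₀(12×12) ≤ -90.9388 → m_s²(12) ∈ [0.0175, 0.257]`. [cite: LiebMattis1962, Theorem 2]
[cite: Tasaki2020, App. A.3] -/
theorem neelOrderParamSq_twelve_mem_Icc_marshall_of_groundEnergy_le (J : ℝ) (hJ : 0 < J)
    (hE : (heisenbergTorus 2 12 1 1).groundEnergy ≤ -90.9388) :
    neelOrderParamSq 12 J ∈ Set.Icc (0.0175 : ℝ) 0.257 :=
  ⟨neelOrderParamSq_twelve_ge_marshall_of_groundEnergy_le J hJ hE, neelOrderParamSq_twelve_le J⟩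

end Summit.HubbardSuperconductivity.HubbardLadder
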